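import Literature.AlgebraicGeometry.Motives.HodgeStructureLefschetzGroupPoints
import Literature.AlgebraicGeometry.Motives.HodgeStructureEndAlgCentralizerPoints
import Literature.Algebra.Lie.KillingBaseChange
import HarnessLib

/-!
# Milne 1999, Proposition 1.3 over a coefficient field `K ⊇ ℚ` (Remark 1.6) for the abstract polarized `ℚ`-Hodge structure:
# the `K`-bilinear forms `B` on `K ⊗ V` with `B(γ x, y) = B(x, γ† y)` for all `γ ∈ C(H)` are exactly the forms
# `Q_K(β ·, ·)` with `β ∈ E_φ ⊗ K`; equivalently the `Hg(H)(K)`-invariant forms, equivalently the `S(H)(K)`-invariant forms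

[topic AlgebraicGeometry/Motives]

Layer `Literature/AlgebraicGeometry/Motives`, lane `lit-hodgefound` (Track 2 foundations library; seat `lit-hodgefound-p34`,
generation 18, self-proposed row g18-#8 of `run/shared/lean/pub/lit-hodgefound/SKELETON.md`). THEOREMS ONLY (no definition,
no named fact; net debt `0`). Eighth file of the seat's programme «Milne 1999 §1 on the abstract polarized `ℚ`-Hodge
structure, on `K`-points»: the `K`-POINTS form of Proposition 1.3 (whose `ℚ`-points form is the seat's g18-#2
`Motives/HodgeStructureCentralizerEquivariantForms`, not imported here). Milne states Prop. 1.3 for a Weil cohomology with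
coefficient field `k`; by Remark 1.6 the theory `H_B ⊗_ℚ K` (Betti cohomology with coefficients extended to a field
`K ⊇ ℚ`) is again one, with `C'(A) = C(A) ⊗ K`, and Prop. 1.3 for it is the statement proved here: for a polarized
`ℚ`-Hodge structure `(H, Q)` and `K`-bilinear forms on `K ⊗_ℚ V`. Objects (all the tree's): `E_φ = H.endAlg`,
`C(H) = Subalgebra.centralizer ℚ E_φ`, `† = Polarization.adjoint` (w.r.t. `Q`), `Q_K = Q.form.baseChange K`,
`E_φ ⊗ K := span_K {a_K : a ∈ E_φ}`, `Hg(H)(K) = H.hodgeGroupBaseChange K`, `S(H)(K) = Q.lefschetzGroupBaseChange K` (g18-#1).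
Over `K` the "divisor classes `e_D`" of Milne's statement are replaced, exactly as in his proof, by the forms `Q_K(β ·, ·)`,
`β ∈ End⁰ ⊗ K = E_φ ⊗ K` ("`ψ = e_{D₀} ∘ (β × 1)` for some `β ∈ End(A) ⊗_ℚ k`").

## The source, verbatim

J. S. Milne, *Lefschetz classes on abelian varieties*, Duke Math. J. **96** (1999) 639–675 [Milne1999LefschetzClasses]
(held `paper:doi-10-1215-s0012-7094-99-09620-5`, author's folios; Duke page ≈ folio + 638):
* §1 p0005 L33–L36 (p. 643): "**Proposition 1.3.** The skew-symmetric `k`-bilinear forms `ψ: V(A) × V(A) → k(1)` such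
  that `ψ ∘ (γ × 1) = ψ ∘ (1 × γ†)`, all `γ ∈ C(A)`, are exactly the `k`-linear combinations of forms `e_D` with `D` a
  divisor on `A`."
* p0005 L40–L47 (proof): "because `e_{D₀}` is non-degenerate, any `k`-bilinear form `ψ: V(A) × V(A) → k(1)` can be written
  `ψ = e_{D₀} ∘ (β × 1)` for some `β ∈ End_k(V(A))`. […] **(1.2)**
  `ψ ∘ (γ × 1) = ψ ∘ (1 × γ†), ∀γ ∈ C(A) ⟹ βγ = γβ, ∀γ ∈ C(A) ⟹ β ∈ End⁰(A) ⊗_ℚ k`. Therefore, any `ψ` as in the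
  statement of the proposition is of the form `e_{D₀} ∘ (β × 1)` for some `β ∈ End⁰(A) ⊗_ℚ k`".
* p0006 L30–L34 (p. 644): "**Remark 1.6.** If `X ↦ H*(X)` is a Weil cohomology theory with coefficient field `k`, and `k'`
  is a field containing `k`, then `X ↦ H*(X) ⊗_k k'` is a Weil cohomology theory with coefficient field `k'` […]
  `C'(A) ≅ C(A) ⊗_k k'`, `S'(A) ≅ S(A)_{/k'}`."
* §3 p0015 L36–L40 (p. 653): "because `γ†γ = 1` for `γ ∈ S(A)(k)`, `ψ` is invariant under `S(A)` if and only if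
  `ψ ∘ (γ × 1) = ψ ∘ (1 × γ†)`, all `γ ∈ S(A)(k)`."

## What is PROVED (polarized pure `ℚ`-HS `(H, Q)`, `V` finite-dimensional, field `K ⊇ ℚ`)

* §0 **`Q_K` is non-degenerate** (`Polarization.baseChange_form_nondegenerate`, from the tree's `Polarization.nondegenerate` and
  `Literature.Algebra.Lie.KillingBaseChange.nondegenerate_baseChange`), **adjointness survives base change**
  `Q_K(a_K x, y) = Q_K(x, (a†)_K y)` (`Polarization.baseChange_form_baseChange_apply_eq_adjoint`), and **representability**
  "`ψ = e_{D₀} ∘ (β × 1)` for a unique `β ∈ End_K(K ⊗ V)`" (`Polarization.existsUnique_baseChange_form_comp`).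
* §1 **Proposition 1.3 / (1.2) over `K`** (every field `K ⊇ ℚ`, any universe): for `B = Q_K(β ·, ·)`,
  `B(c_K x, y) = B(x, (c†)_K y)` for all `c ∈ C(H)` **iff** `β ∈ E_φ ⊗ K`
  (`Polarization.forall_centralizer_baseChange_form_apply_adjoint_iff_mem_span`; "(1.2)": non-degeneracy turns the form
  identity into `β c_K = c_K β`, and the commutant of `C(H) ⊗ K` is `E_φ ⊗ K` — Remark 1.2 on `K`-points, g18-#1).
* §2 **invariance under the groups** (Milne p. 653 "`ψ` is invariant under `S(A)` iff `ψ ∘ (γ × 1) = ψ ∘ (1 × γ†)`"): for an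
  isometry `γ` of `Q_K`, `B` is `γ`-invariant iff `β γ = γ β` (`Polarization.forall_apply_apply_iff_comp_eq_comp_of_isometry`);
  hence `β ∈ E_φ ⊗ K ⟹ B` is `S(H)(K)`-invariant (`…_of_mem_span`, any universe), and for `K` in the universe of `V`:
  **`B` is `Hg(H)(K)`-invariant iff `β ∈ E_φ ⊗ K` iff `B` is `S(H)(K)`-invariant**
  (`Polarization.forall_hodgeGroupBaseChange_form_apply_apply_iff_mem_span`,
  `Polarization.forall_lefschetzGroupBaseChange_form_apply_apply_iff_mem_span`; the commutant of `Hg(H)(K)` is `E_φ ⊗ K`,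
  the tree's `forall_hodgeGroupBaseChange_comm_iff_mem_span_baseChange_endAlg`).

NOT here: the parity clause ("skew-symmetric" / "`β = β†`" over `K`; the `ℚ`-points version is in g18-#2), divisor
classes, the universe-polymorphic form of §2's "⟹" (the tree's `Hg(H)(K)`-commutant theorem pins `K` to the universe of `V`).

## References

* [Milne1999LefschetzClasses] J. S. Milne, *Lefschetz classes on abelian varieties*, Duke Math. J. 96 (1999) 639–675, §1
  Proposition 1.3 and (1.2) (p. 643), Remark 1.6 (p. 644), §3 p. 653.
* [Moonen2004MT] B. Moonen, *An introduction to Mumford–Tate groups* (2004), §5 (5.2) eq. (3) (the commutant of the Hodge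
  group).
* [Huybrechts2016K3] D. Huybrechts, *Lectures on K3 surfaces* (2016), §3.3.5 eq. (3.3) (the adjoint `a†`).
-/

noncomputable section

open TensorProduct

namespace Literature.AlgebraicGeometry.Motives

namespace HodgeStructure

universe u uK

/-! ## §0 `Q_K` is non-degenerate; adjointness after base change; representability -/

section Representability

variable (K : Type uK) [Field K] [Algebra ℚ K] {V : Type u} [AddCommGroup V] [Module ℚ V] [Module.Finite ℚ V] {n : ℤ}
  {H : HodgeStructure V n} (Q : Polarization H)

/-- **`Q_K` is non-degenerate** ("because `e_{D₀}` is non-degenerate", after extension of scalars: a non-degenerate form on a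
finite-dimensional space stays non-degenerate under base change to a field). [cite: Milne1999LefschetzClasses, §1 proof of Prop. 1.3 (p. 643) and Remark 1.6] -/
theorem Polarization.baseChange_form_nondegenerate : (Q.form.baseChange K).Nondegenerate :=
  Literature.Algebra.Lie.KillingBaseChange.nondegenerate_baseChange Q.nondegenerate

omit [Module.Finite ℚ V] in
/-- If `Q(a v, w) = Q(v, b w)` on `V` then `Q_K(a_K x, y) = Q_K(x, b_K y)` on `K ⊗ V` (checked on pure tensors).
Private plumbing. [folklore] -/
private theorem baseChange_form_baseChange_apply_eq {a b : Module.End ℚ V} (h : ∀ v w, Q.form (a v) w = Q.form v (b w))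
    (x y : K ⊗[ℚ] V) :
    Q.form.baseChange K (a.baseChange K x) y = Q.form.baseChange K x (b.baseChange K y) := by
  induction x using TensorProduct.induction_on with
  | zero => simp only [map_zero, LinearMap.zero_apply]
  | tmul c v =>
    induction y using TensorProduct.induction_on with
    | zero => simp only [map_zero]
    | tmul d w => simp only [LinearMap.baseChange_tmul, LinearMap.BilinForm.baseChange_tmul, h]
    | add y₁ y₂ h₁ h₂ => simp only [map_add, h₁, h₂]
  | add x₁ x₂ h₁ h₂ => simp only [map_add, LinearMap.add_apply, h₁, h₂]

/-- **Adjointness survives base change**: `Q_K(a_K x, y) = Q_K(x, (a†)_K y)` for every `a ∈ End_ℚ(V)` (`a† = Q.adjoint a`).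
[cite: Huybrechts2016K3, §3.3.5 eq. (3.3)] [cite: Milne1999LefschetzClasses, §1 Remark 1.6 (p. 644)] -/
theorem Polarization.baseChange_form_baseChange_apply_eq_adjoint (a : Module.End ℚ V) (x y : K ⊗[ℚ] V) :
    Q.form.baseChange K (a.baseChange K x) y = Q.form.baseChange K x ((Q.adjoint a).baseChange K y) :=
  baseChange_form_baseChange_apply_eq K Q (fun v w ↦ (Q.form_apply_adjoint a v w).symm) x y

/-- **"any `k`-bilinear form `ψ` can be written `ψ = e_{D₀} ∘ (β × 1)` for some `β ∈ End_k(V(A))`"**, over `K`: every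
`K`-bilinear form on `K ⊗ V` is `Q_K(β ·, ·)` for a unique `K`-linear `β` (`β = θ_K⁻¹ ∘ B♭`, `θ_K = Q_K♭` an isomorphism by
non-degeneracy). [cite: Milne1999LefschetzClasses, §1 proof of Prop. 1.3 (p. 643) and Remark 1.6] -/
theorem Polarization.existsUnique_baseChange_form_comp (B : LinearMap.BilinForm K (K ⊗[ℚ] V)) :
    ∃! β : Module.End K (K ⊗[ℚ] V), ∀ x y, B x y = Q.form.baseChange K (β x) y := by
  refine ⟨((Q.form.baseChange K).toDual (Q.baseChange_form_nondegenerate K)).symm.toLinearMap ∘ₗ B, fun x y ↦ ?_,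
    fun β' hβ' ↦ ?_⟩
  · rw [LinearMap.comp_apply, LinearEquiv.coe_toLinearMap, LinearMap.BilinForm.apply_toDual_symm_apply]
  · refine LinearMap.ext fun x ↦ ?_
    refine sub_eq_zero.1 ((Q.baseChange_form_nondegenerate K).1 _ fun y ↦ ?_)
    rw [map_sub, LinearMap.sub_apply, ← hβ' x y, LinearMap.comp_apply, LinearEquiv.coe_toLinearMap,
      LinearMap.BilinForm.apply_toDual_symm_apply, sub_self]

end Representability

/-! ## §1 Proposition 1.3 / (1.2) over `K`: `C(H)`-equivariant forms are the `Q_K(β ·, ·)` with `β ∈ E_φ ⊗ K` -/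

section PropOneThree

variable (K : Type uK) [Field K] [Algebra ℚ K] {V : Type u} [AddCommGroup V] [Module ℚ V] [Module.Finite ℚ V]
  [HodgeTensorFacts.{u, u}] {n : ℤ} {H : HodgeStructure V n} (Q : Polarization H)

/-- **Proposition 1.3 with (1.2), over a field `K ⊇ ℚ`**: for a `K`-bilinear form `B = Q_K(β ·, ·)` on `K ⊗ V`,
`B(c_K x, y) = B(x, (c†)_K y)` for every `c ∈ C(H)` iff `β ∈ E_φ ⊗ K` (the `K`-span of the `a_K`, `a ∈ E_φ`). "(1.2)": by
adjointness and non-degeneracy the form identity says `β c_K = c_K β` for all `c ∈ C(H)`, and the commutant of `C(H) ⊗ K` in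
`End_K(K ⊗ V)` is `E_φ ⊗ K` (Remark 1.2 on `K`-points, g18-#1's `forall_centralizer_endAlg_baseChange_comm_iff_mem_span_baseChange_endAlg`).
[cite: Milne1999LefschetzClasses, §1 Prop. 1.3, (1.2) (p. 643) and Remark 1.6 (p. 644)] -/
theorem Polarization.forall_centralizer_baseChange_form_apply_adjoint_iff_mem_span {B : LinearMap.BilinForm K (K ⊗[ℚ] V)}
    {β : Module.End K (K ⊗[ℚ] V)} (hβ : ∀ x y, B x y = Q.form.baseChange K (β x) y) :
    (∀ c ∈ Subalgebra.centralizer ℚ (H.endAlg : Set (Module.End ℚ V)), ∀ x y,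
        B (c.baseChange K x) y = B x ((Q.adjoint c).baseChange K y)) ↔
      β ∈ Submodule.span K (Set.range fun a : H.endAlg ↦ (a : Module.End ℚ V).baseChange K) := by
  rw [← forall_centralizer_endAlg_baseChange_comm_iff_mem_span_baseChange_endAlg K H ⟨Q⟩ β]
  refine forall₂_congr fun c _ ↦ ⟨fun h ↦ LinearMap.ext fun x ↦ ?_, fun h x y ↦ ?_⟩
  · -- (1.2): `Q_K(β c_K x - c_K β x, y) = B(c_K x, y) - B(x, (c†)_K y) = 0` for all `y`
    refine sub_eq_zero.1 ((Q.baseChange_form_nondegenerate K).1 _ fun y ↦ ?_)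
    rw [map_sub, LinearMap.sub_apply, Module.End.mul_apply, Module.End.mul_apply, ← hβ,
      Q.baseChange_form_baseChange_apply_eq_adjoint K c (β x) y, ← hβ, h x y, sub_self]
  · have hx := LinearMap.congr_fun h x
    rw [Module.End.mul_apply, Module.End.mul_apply] at hx
    rw [hβ, hβ, hx, Q.baseChange_form_baseChange_apply_eq_adjoint K]

/-- The easy direction packaged for all forms at once: for `β ∈ E_φ ⊗ K` the form `Q_K(β ·, ·)` is `C(H)`-equivariant in
Milne's sense. [cite: Milne1999LefschetzClasses, §1 Prop. 1.3 (p. 643) and Remark 1.6] -/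
theorem Polarization.forall_centralizer_baseChange_form_apply_adjoint_of_mem_span {β : Module.End K (K ⊗[ℚ] V)}
    (hβ : β ∈ Submodule.span K (Set.range fun a : H.endAlg ↦ (a : Module.End ℚ V).baseChange K)) :
    ∀ c ∈ Subalgebra.centralizer ℚ (H.endAlg : Set (Module.End ℚ V)), ∀ x y,
      Q.form.baseChange K (β (c.baseChange K x)) y = Q.form.baseChange K (β x) ((Q.adjoint c).baseChange K y) :=
  (Q.forall_centralizer_baseChange_form_apply_adjoint_iff_mem_span K (B := (Q.form.baseChange K).compl₁₂ β LinearMap.id)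
    (β := β) fun _ _ ↦ rfl).2 hβ

end PropOneThree

/-! ## §2 Invariance under `Hg(H)(K)` and `S(H)(K)` -/

section Invariance

variable (K : Type uK) [Field K] [Algebra ℚ K] {V : Type u} [AddCommGroup V] [Module ℚ V] [Module.Finite ℚ V] {n : ℤ}
  {H : HodgeStructure V n} (Q : Polarization H)

/-- **"because `γ†γ = 1`, `ψ` is invariant under `γ` iff `ψ ∘ (γ × 1) = ψ ∘ (1 × γ†)`"**, in the form used here: for an
ISOMETRY `γ` of `Q_K` and `B = Q_K(β ·, ·)`, `B(γ x, γ y) = B(x, y)` for all `x, y` iff `β γ = γ β` (non-degeneracy of `Q_K`).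
[cite: Milne1999LefschetzClasses, §3 p. 653 L36–L40 and §1 (1.2)] -/
theorem Polarization.forall_apply_apply_iff_comp_eq_comp_of_isometry {B : LinearMap.BilinForm K (K ⊗[ℚ] V)}
    {β : Module.End K (K ⊗[ℚ] V)} (hβ : ∀ x y, B x y = Q.form.baseChange K (β x) y)
    {γ : (K ⊗[ℚ] V) ≃ₗ[K] (K ⊗[ℚ] V)} (hγ : ∀ x y, Q.form.baseChange K (γ x) (γ y) = Q.form.baseChange K x y) :
    (∀ x y, B (γ x) (γ y) = B x y) ↔
      β ∘ₗ (γ : K ⊗[ℚ] V →ₗ[K] K ⊗[ℚ] V) = (γ : K ⊗[ℚ] V →ₗ[K] K ⊗[ℚ] V) ∘ₗ β := by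
  constructor
  · intro h
    refine LinearMap.ext fun x ↦ sub_eq_zero.1 ((Q.baseChange_form_nondegenerate K).1 _ fun y ↦ ?_)
    -- test against `y = γ y'`: `Q_K(β γ x, γ y') = B(γ x, γ y') = B(x, y') = Q_K(β x, y') = Q_K(γ β x, γ y')`
    obtain ⟨y', rfl⟩ := γ.surjective y
    rw [map_sub, LinearMap.sub_apply, LinearMap.comp_apply, LinearMap.comp_apply, LinearEquiv.coe_coe, ← hβ, h x y', hβ,
      ← hγ (β x) y', sub_self]
  · intro h x y
    have hx := LinearMap.congr_fun h x
    simp only [LinearMap.coe_comp, Function.comp_apply, LinearEquiv.coe_coe] at hx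
    rw [hβ, hβ, hx, hγ]

omit [Module.Finite ℚ V] in
/-- A `K`-linear combination of the `a_K`, `a ∈ E_φ`, commutes with any `g` commuting with every `a_K`. Private plumbing. [folklore] -/
private theorem comp_eq_comp_of_mem_span_range_baseChange {f : Module.End K (K ⊗[ℚ] V)}
    (hf : f ∈ Submodule.span K (Set.range fun a : H.endAlg ↦ (a : Module.End ℚ V).baseChange K))
    {g : Module.End K (K ⊗[ℚ] V)} (hg : ∀ a : H.endAlg, (a : Module.End ℚ V).baseChange K ∘ₗ g = g ∘ₗ (a : Module.End ℚ V).baseChange K) :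
    f ∘ₗ g = g ∘ₗ f := by
  induction hf using Submodule.span_induction with
  | mem f h =>
    obtain ⟨a, rfl⟩ := h
    exact hg a
  | zero => rw [LinearMap.zero_comp, LinearMap.comp_zero]
  | add f f' _ _ hf hf' => rw [LinearMap.add_comp, LinearMap.comp_add, hf, hf']
  | smul c f _ hf => rw [LinearMap.smul_comp, LinearMap.comp_smul, hf]

/-- **`β ∈ E_φ ⊗ K ⟹ Q_K(β ·, ·)` is `S(H)(K)`-invariant** (every field `K ⊇ ℚ`, any universe): an element of `S(H)(K)` commutes
with every `a_K`, hence with `β`, and preserves `Q_K`. [cite: Milne1999LefschetzClasses, §3 p. 653 L36–L40 and §1 Prop. 1.3, Remark 1.6] -/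
theorem Polarization.forall_lefschetzGroupBaseChange_form_apply_apply_of_mem_span {B : LinearMap.BilinForm K (K ⊗[ℚ] V)}
    {β : Module.End K (K ⊗[ℚ] V)} (hβ : ∀ x y, B x y = Q.form.baseChange K (β x) y)
    (hmem : β ∈ Submodule.span K (Set.range fun a : H.endAlg ↦ (a : Module.End ℚ V).baseChange K)) :
    ∀ γ ∈ Q.lefschetzGroupBaseChange K, ∀ x y, B (γ x) (γ y) = B x y := fun _ hγ ↦
  (Q.forall_apply_apply_iff_comp_eq_comp_of_isometry K hβ hγ.2).2
    (comp_eq_comp_of_mem_span_range_baseChange K hmem fun a ↦ LinearMap.ext fun x ↦ hγ.1 a x)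

variable [HodgeTensorFacts.{u, u}]

/-- `β ∈ E_φ ⊗ K ⟹ Q_K(β ·, ·)` is `Hg(H)(K)`-invariant (through `Hg(H)(K) ⊆ S(H)(K)`, g18-#1).
[cite: Milne1999LefschetzClasses, §4 p. 660 ("L(A) ⊃ Hg(A)") and §1 Prop. 1.3] -/
theorem Polarization.forall_hodgeGroupBaseChange_form_apply_apply_of_mem_span {B : LinearMap.BilinForm K (K ⊗[ℚ] V)}
    {β : Module.End K (K ⊗[ℚ] V)} (hβ : ∀ x y, B x y = Q.form.baseChange K (β x) y)
    (hmem : β ∈ Submodule.span K (Set.range fun a : H.endAlg ↦ (a : Module.End ℚ V).baseChange K)) :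
    ∀ γ ∈ H.hodgeGroupBaseChange K, ∀ x y, B (γ x) (γ y) = B x y := fun γ hγ ↦
  Q.forall_lefschetzGroupBaseChange_form_apply_apply_of_mem_span K hβ hmem γ
    (Q.hodgeGroupBaseChange_le_lefschetzGroupBaseChange K hγ)

end Invariance

section InvarianceIff

variable (K : Type u) [Field K] [Algebra ℚ K] {V : Type u} [AddCommGroup V] [Module ℚ V] [Module.Finite ℚ V]
  [HodgeTensorFacts.{u, u}] {n : ℤ} {H : HodgeStructure V n} (Q : Polarization H)

/-- **The `Hg(H)(K)`-invariant `K`-bilinear forms on `K ⊗ V` are exactly the `Q_K(β ·, ·)` with `β ∈ E_φ ⊗ K`** (`K ⊇ ℚ` a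
field in the universe of `V`): invariance under the isometry `γ ∈ Hg(H)(K)` of `Q_K` says `β γ = γ β` (§2), and the commutant
of `Hg(H)(K)` in `End_K(K ⊗ V)` is `E_φ ⊗ K` (the tree's `forall_hodgeGroupBaseChange_comm_iff_mem_span_baseChange_endAlg`).
With §1: `Hg(H)(K)`-invariant iff `C(H)`-equivariant in Milne's sense. [cite: Milne1999LefschetzClasses, §1 Prop. 1.3 (p. 643), Remark 1.6 and §3 p. 653]
[cite: Moonen2004MT, §5 (5.2) eq. (3)] -/
theorem Polarization.forall_hodgeGroupBaseChange_form_apply_apply_iff_mem_span {B : LinearMap.BilinForm K (K ⊗[ℚ] V)}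
    {β : Module.End K (K ⊗[ℚ] V)} (hβ : ∀ x y, B x y = Q.form.baseChange K (β x) y) :
    (∀ γ ∈ H.hodgeGroupBaseChange K, ∀ x y, B (γ x) (γ y) = B x y) ↔
      β ∈ Submodule.span K (Set.range fun a : H.endAlg ↦ (a : Module.End ℚ V).baseChange K) := by
  rw [← forall_hodgeGroupBaseChange_comm_iff_mem_span_baseChange_endAlg K H β]
  exact forall₂_congr fun γ hγ ↦
    Q.forall_apply_apply_iff_comp_eq_comp_of_isometry K hβ (Q.baseChange_form_apply_apply_of_mem_hodgeGroupBaseChange K hγ)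

/-- **The `S(H)(K)`-invariant `K`-bilinear forms on `K ⊗ V` are exactly the `Q_K(β ·, ·)` with `β ∈ E_φ ⊗ K`** — equivalently
(§1) the `C(H)`-equivariant ones, equivalently the `Hg(H)(K)`-invariant ones ("`ψ` is invariant under `S(A)` iff
`ψ ∘ (γ × 1) = ψ ∘ (1 × γ†)` for all `γ ∈ S(A)(k)`", and "the `k`-algebra `C(A)` is generated by the `γ ∈ S(A)(k)`", here through
`Hg(H)(K) ⊆ S(H)(K)`); `K ⊇ ℚ` a field in the universe of `V`. [cite: Milne1999LefschetzClasses, §3 p. 653 L36–L46 and §1 Prop. 1.3, Remark 1.6] -/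
theorem Polarization.forall_lefschetzGroupBaseChange_form_apply_apply_iff_mem_span {B : LinearMap.BilinForm K (K ⊗[ℚ] V)}
    {β : Module.End K (K ⊗[ℚ] V)} (hβ : ∀ x y, B x y = Q.form.baseChange K (β x) y) :
    (∀ γ ∈ Q.lefschetzGroupBaseChange K, ∀ x y, B (γ x) (γ y) = B x y) ↔
      β ∈ Submodule.span K (Set.range fun a : H.endAlg ↦ (a : Module.End ℚ V).baseChange K) :=
  ⟨fun h ↦ (Q.forall_hodgeGroupBaseChange_form_apply_apply_iff_mem_span K hβ).1 fun γ hγ ↦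
      h γ (Q.hodgeGroupBaseChange_le_lefschetzGroupBaseChange K hγ),
    Q.forall_lefschetzGroupBaseChange_form_apply_apply_of_mem_span K hβ⟩

/-- **The three readings agree** (`K` in the universe of `V`): for `B = Q_K(β ·, ·)`, `C(H)`-equivariance in Milne's sense
`B(c_K x, y) = B(x, (c†)_K y)` is equivalent to `S(H)(K)`-invariance. [cite: Milne1999LefschetzClasses, §3 p. 653 L36–L46 and §1 Prop. 1.3] -/
theorem Polarization.forall_centralizer_baseChange_form_apply_adjoint_iff_forall_lefschetzGroupBaseChange
    {B : LinearMap.BilinForm K (K ⊗[ℚ] V)} {β : Module.End K (K ⊗[ℚ] V)} (hβ : ∀ x y, B x y = Q.form.baseChange K (β x) y) :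
    (∀ c ∈ Subalgebra.centralizer ℚ (H.endAlg : Set (Module.End ℚ V)), ∀ x y,
        B (c.baseChange K x) y = B x ((Q.adjoint c).baseChange K y)) ↔
      ∀ γ ∈ Q.lefschetzGroupBaseChange K, ∀ x y, B (γ x) (γ y) = B x y := by
  rw [Q.forall_centralizer_baseChange_form_apply_adjoint_iff_mem_span K hβ,
    Q.forall_lefschetzGroupBaseChange_form_apply_apply_iff_mem_span K hβ]

end InvarianceIff

end HodgeStructure

end Literature.AlgebraicGeometry.Motives
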